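import Mathlib
import Summits.Ventures.PercRepro2.V2SP
import Summits.Ventures.PercRepro2.Tail2DStepRowZero
import Summits.Ventures.PercRepro2.Tail2DStepCert
import Summits.Ventures.PercRepro2.Tail2DUnitStep

/-!
# The QSTEP weight `qpsi i j r b = (i+1)·[r = i+1 ∧ b ≥ j−1] − j·[r = i ∧ b ≥ j]` and its toolbox
(seat mine-b, cell pub-perc-repro2; MINE-B.md §39.15, §39.17)

QSTEP(i,j): `j·#{r = i ∧ b ≥ j} ≤ (i+1)·#{r = i+1 ∧ b ≥ j−1}` — the binomial-ratio form of STEP (§10.3c), tight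
on every bundle.  Here its weight `qpsi`, the count identity (`sum_qpsi_eq`), the equivalence with the count form
(`qstep_iff`), the capping lemmas for the kernel-decided certificates (`qpsi_cap`, `qpsi_cap_sum`, the same shape as
`psi_cap` / `psi_cap_sum`), and the SERIES step (`qstep_ser`: QSTEP of both factors and the anti-diagonal comparisons
of the tails give QSTEP of the series composition, through `card_H_ser`).
-/

namespace Summit.Ventures.PercRepro2.Tail2D

open V2Closure

/-- the QSTEP weight `(i+1)·[r = i+1 ∧ b ≥ j−1] − j·[r = i ∧ b ≥ j]` (with `b ≥ j−1` written `j ≤ b+1`) -/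
def qpsi (i j r b : ℕ) : ℤ :=
  (if r = i + 1 ∧ j ≤ b + 1 then ((i : ℤ) + 1) else 0) - (if r = i ∧ j ≤ b then (j : ℤ) else 0)

section Counts

variable (s : V2Closure.SP)

/-- the count of the QSTEP weight -/
lemma sum_qpsi_eq (i j : ℕ) :
    ∑ x, qpsi i j (s.rLab x) (s.bLab x)
      = ((i : ℤ) + 1) * ((Finset.univ.filter (fun y : s.Conf => s.rLab y = i + 1 ∧ j ≤ s.bLab y + 1)).card : ℤ)
        - (j : ℤ) * ((Finset.univ.filter (fun y : s.Conf => s.rLab y = i ∧ j ≤ s.bLab y)).card : ℤ) := by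
  rw [Finset.card_filter, Finset.card_filter]
  push_cast
  rw [Finset.mul_sum, Finset.mul_sum, ← Finset.sum_sub_distrib]
  refine Finset.sum_congr rfl (fun y _ => ?_)
  unfold qpsi
  split_ifs <;> simp

/-- QSTEP(i,j) as a count inequality and as the sign of the count of `qpsi i j` -/
lemma qstep_iff (i j : ℕ) :
    j * (Finset.univ.filter (fun y : s.Conf => s.rLab y = i ∧ j ≤ s.bLab y)).card
        ≤ (i + 1) * (Finset.univ.filter (fun y : s.Conf => s.rLab y = i + 1 ∧ j ≤ s.bLab y + 1)).card
      ↔ 0 ≤ ∑ x, qpsi i j (s.rLab x) (s.bLab x) := by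
  rw [sum_qpsi_eq]
  constructor
  · intro h; have := (Nat.cast_le (α := ℤ)).2 h; push_cast at this; linarith
  · intro h; have : ((j * (Finset.univ.filter (fun y : s.Conf => s.rLab y = i ∧ j ≤ s.bLab y)).card : ℕ) : ℤ)
        ≤ (((i + 1) * (Finset.univ.filter (fun y : s.Conf => s.rLab y = i + 1 ∧ j ≤ s.bLab y + 1)).card : ℕ) : ℤ) := by
      push_cast; linarith
    exact_mod_cast this

/-- the count form with `j − 1 ≤ b` and the weight form with `j ≤ b + 1` agree -/
lemma qstep_iff' (i j : ℕ) :
    j * (Finset.univ.filter (fun y : s.Conf => s.rLab y = i ∧ j ≤ s.bLab y)).card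
        ≤ (i + 1) * (Finset.univ.filter (fun y : s.Conf => s.rLab y = i + 1 ∧ j - 1 ≤ s.bLab y)).card
      ↔ 0 ≤ ∑ x, qpsi i j (s.rLab x) (s.bLab x) := by
  rw [← qstep_iff]
  have e : (Finset.univ.filter (fun y : s.Conf => s.rLab y = i + 1 ∧ j - 1 ≤ s.bLab y))
      = Finset.univ.filter (fun y : s.Conf => s.rLab y = i + 1 ∧ j ≤ s.bLab y + 1) := by
    ext y; simp only [Finset.mem_filter, Finset.mem_univ, true_and]; omega
  rw [e]

/-- QSTEP from the unit-STEP family -/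
lemma qstep_of_unitStep' (i j : ℕ) (h : UnitStep s i j) : 0 ≤ ∑ x, qpsi i j (s.rLab x) (s.bLab x) :=
  (qstep_iff' s i j).1 (qstep_of_unitStep s i j h)

end Counts

section Cap

/-- capping the labels at `K` does not change the weight `qpsi k l` when `k + 1 < K` and `l ≤ K` -/
lemma qpsi_cap (k l K r b : ℕ) (hk : k + 1 < K) (hl : l ≤ K) :
    qpsi k l (min r K) (min b K) = qpsi k l r b := by
  unfold qpsi; split_ifs <;> omega

/-- the QSTEP weight of the sums of labels depends only on the capped labels (`i + 2 ≤ K`, `j ≤ K`) -/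
lemma qpsi_cap_sum (i j K r b u v : ℕ) (hi : i + 2 ≤ K) (hj : j ≤ K) :
    qpsi i j (min r K + min u K) (min b K + min v K) = qpsi i j (r + u) (b + v) := by
  unfold qpsi; split_ifs <;> omega

end Cap

section Series

variable (s t : V2Closure.SP)

/-- **the series step of QSTEP(i,j)**: QSTEP of both factors and the anti-diagonal comparisons
`T₂(i,j) ≤ T₂(i+1,j−1)`, `T₁(i+1,j) ≤ T₁(i+2,j−1)` give QSTEP of the composition (through `card_H_ser`) -/
theorem qstep_ser (i j : ℕ)
    (hs : j * (Finset.univ.filter (fun y : s.Conf => s.rLab y = i ∧ j ≤ s.bLab y)).card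
      ≤ (i + 1) * (Finset.univ.filter (fun y : s.Conf => s.rLab y = i + 1 ∧ j - 1 ≤ s.bLab y)).card)
    (ht : j * (Finset.univ.filter (fun y : t.Conf => t.rLab y = i ∧ j ≤ t.bLab y)).card
      ≤ (i + 1) * (Finset.univ.filter (fun y : t.Conf => t.rLab y = i + 1 ∧ j - 1 ≤ t.bLab y)).card)
    (hTt : (Finset.univ.filter (fun y : t.Conf => i ≤ t.rLab y ∧ j ≤ t.bLab y)).card
      ≤ (Finset.univ.filter (fun y : t.Conf => i + 1 ≤ t.rLab y ∧ j - 1 ≤ t.bLab y)).card)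
    (hTs : (Finset.univ.filter (fun y : s.Conf => i + 1 ≤ s.rLab y ∧ j ≤ s.bLab y)).card
      ≤ (Finset.univ.filter (fun y : s.Conf => i + 1 + 1 ≤ s.rLab y ∧ j - 1 ≤ s.bLab y)).card) :
    j * (Finset.univ.filter (fun y : (V2Closure.SP.ser s t).Conf =>
        (V2Closure.SP.ser s t).rLab y = i ∧ j ≤ (V2Closure.SP.ser s t).bLab y)).card
      ≤ (i + 1) * (Finset.univ.filter (fun y : (V2Closure.SP.ser s t).Conf =>
        (V2Closure.SP.ser s t).rLab y = i + 1 ∧ j - 1 ≤ (V2Closure.SP.ser s t).bLab y)).card := by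
  rw [card_H_ser, card_H_ser]
  calc j * ((Finset.univ.filter (fun y : s.Conf => s.rLab y = i ∧ j ≤ s.bLab y)).card
          * (Finset.univ.filter (fun y : t.Conf => i ≤ t.rLab y ∧ j ≤ t.bLab y)).card
        + (Finset.univ.filter (fun y : s.Conf => i + 1 ≤ s.rLab y ∧ j ≤ s.bLab y)).card
          * (Finset.univ.filter (fun y : t.Conf => t.rLab y = i ∧ j ≤ t.bLab y)).card)
      = (j * (Finset.univ.filter (fun y : s.Conf => s.rLab y = i ∧ j ≤ s.bLab y)).card)
          * (Finset.univ.filter (fun y : t.Conf => i ≤ t.rLab y ∧ j ≤ t.bLab y)).card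
        + (Finset.univ.filter (fun y : s.Conf => i + 1 ≤ s.rLab y ∧ j ≤ s.bLab y)).card
          * (j * (Finset.univ.filter (fun y : t.Conf => t.rLab y = i ∧ j ≤ t.bLab y)).card) := by ring
    _ ≤ ((i + 1) * (Finset.univ.filter (fun y : s.Conf => s.rLab y = i + 1 ∧ j - 1 ≤ s.bLab y)).card)
          * (Finset.univ.filter (fun y : t.Conf => i + 1 ≤ t.rLab y ∧ j - 1 ≤ t.bLab y)).card
        + (Finset.univ.filter (fun y : s.Conf => i + 1 + 1 ≤ s.rLab y ∧ j - 1 ≤ s.bLab y)).card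
          * ((i + 1) * (Finset.univ.filter (fun y : t.Conf => t.rLab y = i + 1 ∧ j - 1 ≤ t.bLab y)).card) :=
        Nat.add_le_add (Nat.mul_le_mul hs hTt) (Nat.mul_le_mul hTs ht)
    _ = (i + 1) * ((Finset.univ.filter (fun y : s.Conf => s.rLab y = i + 1 ∧ j - 1 ≤ s.bLab y)).card
          * (Finset.univ.filter (fun y : t.Conf => i + 1 ≤ t.rLab y ∧ j - 1 ≤ t.bLab y)).card
        + (Finset.univ.filter (fun y : s.Conf => i + 1 + 1 ≤ s.rLab y ∧ j - 1 ≤ s.bLab y)).card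
          * (Finset.univ.filter (fun y : t.Conf => t.rLab y = i + 1 ∧ j - 1 ≤ t.bLab y)).card) := by ring

end Series

end Summit.Ventures.PercRepro2.Tail2D
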